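import Summits.CriticalPhenomena.SAWScalingLimit.Theorems.SAWTotalPositivityCriticalBubbleBoundJoinCaseA
import Summits.CriticalPhenomena.SAWScalingLimit.Theorems.SAWTotalPositivityCriticalBubbleBoundJoinCaseB1C1
import Summits.CriticalPhenomena.SAWScalingLimit.Theorems.SAWTotalPositivityCriticalBubbleBoundJoinCaseB2aC2a
import Summits.CriticalPhenomena.SAWScalingLimit.Theorems.SAWTotalPositivityCriticalBubbleBoundJoinCaseB2bC2b
import Summits.CriticalPhenomena.SAWScalingLimit.Theorems.SAWTotalPositivityCriticalBubbleBoundJoinCaseWindow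
import Summits.CriticalPhenomena.SAWScalingLimit.Theorems.SAWTotalPositivityCriticalBubbleBoundJoinContact
import Summits.CriticalPhenomena.SAWScalingLimit.Theorems.SAWTotalPositivityCriticalBubbleBoundJoinFrames

/-!
# The two sides of the Madras join: the uniform modification and the partner through the rotation
(line `docking-census-joining`, helpers of stub `joinPoly_spec`; registered helper stubs
`modify_uniform`, `sigma_side`)

Crux `stmt-CriticalPhenomena-7117`
(`Summit.CriticalPhenomena.SAWScalingLimit.Theses.SAWTotalPositivity.CriticalBubbleBound`), line
`docking-census-joining` (lead c6, JOIN-MASS programme, wave 3). Madras' joining surgery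
(Hammond, Ann. Probab. 46 (2018) = arXiv:1808.09032, §4.1; objects of `…JoinSurgeryDefs`) modifies a
polygon `E` at the window `Y` in one of eight local cases (`modify_spec_*` of the four case files).
This file packages them for the join assembly:

* `modify_uniform` — the eight cases behind ONE statement indexed by `outOff (caseOf E Y)`: given a
  polygon with vertex-free right corridor whose vertical 3-window at `Y` meets it, `modify E Y` is a
  polygon with `#E + 8` edges carrying the vertical 2-segment of column `Y 0 + outOff`, nothing of it
  lies right of that column in the window rows, its vertices are old vertices or fresh cells in the box
  `[Y 0, Y 0 + outOff] × [a 1 - 2, a 1 + 2]` around the window vertex `a`, every old vertex other than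
  the dropped corner survives, and `unmodify` inverts it;
* `isV_modify_e₀` — for a lex-rooted polygon and a window on a row `≥ 2`, the endpoint `e₀` of the
  root edge survives the modification (the dropped corner of case `C2b` cannot be `e₀`: its right
  neighbour would be a vertex with a polygon-neighbour on row `-1`);
* `sigma_side` — the PARTNER's modification `rotE Y (modify (rotE Y S) Y)` (rotate by `π` about `Y`,
  modify, rotate back) translated by `(T, 0)`: polygon, `#S + 8` edges, the vertical 2-segment of column
  `Y 0 + T - outOff`, nothing left of it in the window rows, vertex bookkeeping, survival, inversion —
  `modify_uniform` read through the frame lemmas of `…JoinFrames`.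
-/

noncomputable section

open Literature.Probability.LatticeModels
open Literature.Probability.RandomPlanarGeometry Literature.Probability.RandomPlanarGeometry.SAW
open scoped BigOperators
open Summit.CriticalPhenomena.SAWScalingLimit.Theorems.CriticalBubbleBound.Negative (e₀)
open Summit.CriticalPhenomena.SAWScalingLimit.Theorems.CriticalBubbleBound.Docking

namespace Summit.CriticalPhenomena.SAWScalingLimit.Theorems.CriticalBubbleBound.Join

/-! ## Coordinates -/

/-- Two sites of `ℤ²` with equal coordinates are equal. [folklore] -/
private theorem site_eq {x y : Site 2} (h0 : x 0 = y 0) (h1 : x 1 = y 1) : x = y :=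
  funext (Fin.forall_fin_two.2 ⟨h0, h1⟩)

/-- Coordinates of `pt Y (a, b) = Y + (a, b)`. [folklore] -/
private theorem pt_mk_apply (Y : Site 2) (a b : ℤ) :
    pt Y (a, b) 0 = Y 0 + a ∧ pt Y (a, b) 1 = Y 1 + b := by
  simp [pt]

/-- Coordinates of `x + (s, t)`. [folklore] -/
private theorem vadd_apply (x : Site 2) (s t : ℤ) :
    (x + ![s, t]) 0 = x 0 + s ∧ (x + ![s, t]) 1 = x 1 + t := ⟨rfl, rfl⟩

/-- Coordinates of `x - (s, t)`. [folklore] -/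
private theorem vsub_apply (x : Site 2) (s t : ℤ) :
    (x - ![s, t]) 0 = x 0 - s ∧ (x - ![s, t]) 1 = x 1 - t := ⟨rfl, rfl⟩

/-- Coordinates of `rotY Y p = 2Y - p`. [folklore] -/
private theorem rotY_coord (Y p : Site 2) :
    rotY Y p 0 = 2 * Y 0 - p 0 ∧ rotY Y p 1 = 2 * Y 1 - p 1 := by
  rw [rotY_apply, rotY_apply]
  exact ⟨by ring, by ring⟩

/-- The rotation about `Y` maps `Y + (s, t)` to `Y + (-s, -t)`. [folklore] -/
private theorem rotY_vadd (Y : Site 2) (s t : ℤ) : rotY Y (Y + ![s, t]) = Y + ![-s, -t] := by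
  obtain ⟨h0, h1⟩ := rotY_coord Y (Y + ![s, t])
  obtain ⟨k0, k1⟩ := vadd_apply Y s t
  obtain ⟨l0, l1⟩ := vadd_apply Y (-s) (-t)
  exact site_eq (by omega) (by omega)

/-- The rotation about `Y` on the vertical 3-window of `Y`. [folklore] -/
private theorem rotY_window (Y : Site 2) :
    rotY Y (Y - e₁) = Y + e₁ ∧ rotY Y Y = Y ∧ rotY Y (Y + e₁) = Y - e₁ := by
  obtain ⟨-, -, k0, k1⟩ := e₀_e₁_apply
  obtain ⟨a0, a1⟩ := rotY_coord Y (Y - e₁)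
  obtain ⟨b0, b1⟩ := rotY_coord Y Y
  obtain ⟨c0, c1⟩ := rotY_coord Y (Y + e₁)
  refine ⟨site_eq ?_ ?_, site_eq ?_ ?_, site_eq ?_ ?_⟩ <;>
    simp only [Pi.add_apply, Pi.sub_apply, k0, k1] at * <;> omega

/-! ## The uniform modification -/

/-- Uniformisation of one case: the conclusions of `modify_spec_c` for the case `c = caseOf E Y`
with output offset `o = outOff c` and window vertex `a` give the uniform statement. [folklore] -/
private theorem uniform_of_spec {E : Finset (Sym2 (Site 2))} {Y : Site 2} {c : JCase} {o : ℤ}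
    (hc : caseOf E Y = c) (ho : outOff c = o)
    (h : IsPolygon (zdGraph 2) (modify E Y) ∧ (modify E Y).card = E.card + 8 ∧
      s(pt Y (o, -1), pt Y (o, 0)) ∈ modify E Y ∧ s(pt Y (o, 0), pt Y (o, 1)) ∈ modify E Y ∧
      (∀ p : Site 2, IsV (modify E Y) p → -1 ≤ p 1 - Y 1 → p 1 - Y 1 ≤ 1 → p 0 ≤ Y 0 + o) ∧
      (∀ p : Site 2, IsV (modify E Y) p → IsV E p ∨ p ∈ newCells c Y) ∧
      (∀ p : Site 2, IsV E p → (p = pt Y (0, 2) → c ≠ JCase.B2b) →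
        (p = pt Y (0, -2) → c ≠ JCase.C2b) → IsV (modify E Y) p) ∧
      unmodify c (modify E Y) Y = E)
    {a : Site 2} (ha : IsV E a)
    (hfam : ((c = JCase.Aup ∨ c = JCase.Adown) ∧ a = Y) ∨
      ((c = JCase.B1 ∨ c = JCase.B2a ∨ c = JCase.B2b) ∧ a = Y + e₁) ∨
      ((c = JCase.C1 ∨ c = JCase.C2a ∨ c = JCase.C2b) ∧ a = Y - e₁)) :
    IsPolygon (zdGraph 2) (modify E Y) ∧ (modify E Y).card = E.card + 8 ∧
      s(pt Y (outOff (caseOf E Y), -1), pt Y (outOff (caseOf E Y), 0)) ∈ modify E Y ∧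
      s(pt Y (outOff (caseOf E Y), 0), pt Y (outOff (caseOf E Y), 1)) ∈ modify E Y ∧
      (∀ p : Site 2, IsV (modify E Y) p → -1 ≤ p 1 - Y 1 → p 1 - Y 1 ≤ 1 →
        p 0 ≤ Y 0 + outOff (caseOf E Y)) ∧
      (∃ a : Site 2, IsV E a ∧ a 0 = Y 0 ∧ Y 1 - 1 ≤ a 1 ∧ a 1 ≤ Y 1 + 1 ∧
        ∀ p : Site 2, IsV (modify E Y) p → IsV E p ∨
          (Y 0 ≤ p 0 ∧ p 0 ≤ Y 0 + outOff (caseOf E Y) ∧ a 1 - 2 ≤ p 1 ∧ p 1 ≤ a 1 + 2)) ∧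
      (∀ p : Site 2, IsV E p → (p = pt Y (0, 2) → caseOf E Y ≠ JCase.B2b) →
        (p = pt Y (0, -2) → caseOf E Y ≠ JCase.C2b) → IsV (modify E Y) p) ∧
      unmodify (caseOf E Y) (modify E Y) Y = E := by
  obtain ⟨h1, h2, h3, h4, h5, h6, h7, h8⟩ := h
  obtain ⟨-, -, k0, k1⟩ := e₀_e₁_apply
  have ha01 : a 0 = Y 0 ∧ Y 1 - 1 ≤ a 1 ∧ a 1 ≤ Y 1 + 1 := by
    rcases hfam with ⟨-, rfl⟩ | ⟨-, rfl⟩ | ⟨-, rfl⟩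
    · exact ⟨rfl, by omega, by omega⟩
    · simp only [Pi.add_apply, k0, k1]; omega
    · simp only [Pi.sub_apply, k0, k1]; omega
  -- where the fresh cells lie, relative to the window vertex `a`
  have hcells : ∀ p ∈ newCells c Y,
      Y 0 ≤ p 0 ∧ p 0 ≤ Y 0 + o ∧ a 1 - 2 ≤ p 1 ∧ p 1 ≤ a 1 + 2 := by
    intro p hp
    obtain ⟨l1, l2, l3, l4, -, l6, l7, l8⟩ := newCells_window c Y p hp
    refine ⟨l1, ?_, ?_⟩
    · rw [← ho]
      rcases outOff_eq c with ho2 | ho3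
      · rw [ho2]
        refine l8 ?_
        revert ho2
        cases c <;> decide
      · rw [ho3]
        exact l2
    · rcases hfam with ⟨-, rfl⟩ | ⟨hB, rfl⟩ | ⟨hC, rfl⟩
      · exact ⟨by omega, by omega⟩
      · have := l6 hB
        simp only [Pi.add_apply, k1]; omega
      · have := l7 hC
        simp only [Pi.sub_apply, k1]; omega
  subst hc ho
  exact ⟨h1, h2, h3, h4, h5, ⟨a, ha, ha01.1, ha01.2.1, ha01.2.2, fun p hp =>
    (h6 p hp).elim Or.inl fun hn => Or.inr (hcells p hn)⟩, h7, h8⟩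

/-- **The uniform modification.** Let `E` be a polygon of `ℤ²` and `Y` a site whose right corridor
`{Y + (s, t) : s ≥ 1, |t| ≤ 1}` contains no vertex of `E` and whose vertical 3-window meets `E`. Then,
with `o = outOff (caseOf E Y) ∈ {2, 3}`: `modify E Y` is a polygon with `#E + 8` edges; it contains the
vertical 2-segment `{Y + (o, -1), Y + (o, 0)}`, `{Y + (o, 0), Y + (o, 1)}`; its vertices in the three
window rows have abscissa `≤ Y 0 + o`; its vertices are vertices of `E` or fresh cells in the box
`[Y 0, Y 0 + o] × [a 1 - 2, a 1 + 2]` for a window vertex `a ∈ {Y - e₁, Y, Y + e₁}` of `E`; every vertex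
of `E` survives except possibly the dropped corner (`Y + (0, 2)` in case `B2b`, `Y - (0, 2)` in case
`C2b`); and `unmodify` recovers `E`. [cite: Hammond2015SAPJoining, §4.1 (Madras' modification, the eight cases)] -/
theorem modify_uniform : ∀ (E : Finset (Sym2 (Site 2))) (Y : Site 2), IsPolygon (zdGraph 2) E → (∀ s t : ℤ, 1 ≤ s → -1 ≤ t → t ≤ 1 → ¬ IsV E (Y + ![s, t])) → (IsV E (Y - e₁) ∨ IsV E Y ∨ IsV E (Y + e₁)) → IsPolygon (zdGraph 2) (modify E Y) ∧ (modify E Y).card = E.card + 8 ∧ s(pt Y (outOff (caseOf E Y), -1), pt Y (outOff (caseOf E Y), 0)) ∈ modify E Y ∧ s(pt Y (outOff (caseOf E Y), 0), pt Y (outOff (caseOf E Y), 1)) ∈ modify E Y ∧ (∀ p : Site 2, IsV (modify E Y) p → -1 ≤ p 1 - Y 1 → p 1 - Y 1 ≤ 1 → p 0 ≤ Y 0 + outOff (caseOf E Y)) ∧ (∃ a : Site 2, IsV E a ∧ a 0 = Y 0 ∧ Y 1 - 1 ≤ a 1 ∧ a 1 ≤ Y 1 + 1 ∧ ∀ p :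 Site 2, IsV (modify E Y) p → IsV E p ∨ (Y 0 ≤ p 0 ∧ p 0 ≤ Y 0 + outOff (caseOf E Y) ∧ a 1 - 2 ≤ p 1 ∧ p 1 ≤ a 1 + 2)) ∧ (∀ p : Site 2, IsV E p → (p = pt Y (0, 2) → caseOf E Y ≠ JCase.B2b) → (p = pt Y (0, -2) → caseOf E Y ≠ JCase.C2b) → IsV (modify E Y) p) ∧ unmodify (caseOf E Y) (modify E Y) Y = E := by
  intro E Y hE hcorr hwin
  rcases caseOf_window E Y hwin with ⟨hA, hY⟩ | ⟨hB, -, hY₁⟩ | ⟨hC, -, -, hY₂⟩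
  · rcases hA with hc | hc
    · obtain ⟨h1, h2, h3, h4, h5, h6, h7, h8⟩ := modify_spec_Aup E Y hE hc hcorr
      exact uniform_of_spec hc rfl ⟨h1, h2, h3, h4, h5, h6, fun p hp _ _ => h7 p hp, h8⟩ hY
        (Or.inl ⟨Or.inl rfl, rfl⟩)
    · obtain ⟨h1, h2, h3, h4, h5, h6, h7, h8⟩ := modify_spec_Adown E Y hE hc hcorr
      exact uniform_of_spec hc rfl ⟨h1, h2, h3, h4, h5, h6, fun p hp _ _ => h7 p hp, h8⟩ hY
        (Or.inl ⟨Or.inr rfl, rfl⟩)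
  · rcases hB with hc | hc | hc
    · obtain ⟨h1, h2, h3, h4, h5, h6, h7, h8⟩ := modify_spec_B1 E Y hE hc hcorr
      exact uniform_of_spec hc rfl ⟨h1, h2, h3, h4, h5, h6, fun p hp _ _ => h7 p hp, h8⟩ hY₁
        (Or.inr (Or.inl ⟨Or.inl rfl, rfl⟩))
    · obtain ⟨h1, h2, h3, h4, h5, h6, h7, h8⟩ := modify_spec_B2a E Y hE hc hcorr
      exact uniform_of_spec hc rfl ⟨h1, h2, h3, h4, h5, h6, fun p hp _ _ => h7 p hp, h8⟩ hY₁
        (Or.inr (Or.inl ⟨Or.inr (Or.inl rfl), rfl⟩))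
    · obtain ⟨h1, h2, h3, h4, h5, h6, h7, h8⟩ := modify_spec_B2b E Y hE hc hcorr
      exact uniform_of_spec hc rfl
        ⟨h1, h2, h3, h4, h5, h6, fun p hp hne _ => h7 p hp fun heq => hne heq rfl, h8⟩ hY₁
        (Or.inr (Or.inl ⟨Or.inr (Or.inr rfl), rfl⟩))
  · rcases hC with hc | hc | hc
    · obtain ⟨h1, h2, h3, h4, h5, h6, h7, h8⟩ := modify_spec_C1 E Y hE hc hY₂ hcorr
      exact uniform_of_spec hc rfl ⟨h1, h2, h3, h4, h5, h6, fun p hp _ _ => h7 p hp, h8⟩ hY₂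
        (Or.inr (Or.inr ⟨Or.inl rfl, rfl⟩))
    · obtain ⟨h1, h2, h3, h4, h5, h6, h7, h8⟩ := modify_spec_C2a E Y hE hc hY₂ hcorr
      exact uniform_of_spec hc rfl ⟨h1, h2, h3, h4, h5, h6, fun p hp _ _ => h7 p hp, h8⟩ hY₂
        (Or.inr (Or.inr ⟨Or.inr (Or.inl rfl), rfl⟩))
    · obtain ⟨h1, h2, h3, h4, h5, h6, h7, h8⟩ := modify_spec_C2b E Y hE hc hY₂ hcorr
      exact uniform_of_spec hc rfl
        ⟨h1, h2, h3, h4, h5, h6, fun p hp _ hne => h7 p hp fun heq => hne heq rfl, h8⟩ hY₂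
        (Or.inr (Or.inr ⟨Or.inr (Or.inr rfl), rfl⟩))

/-! ## The root survives -/

/-- **The root survives the modification.** For `χ ∈ lexRooted j` (all vertices on rows `≥ 0`) and
a window `Y` on a row `≥ 2` with vertex-free right corridor, the endpoint `e₀` of the root edge is
still a vertex of `modify (pedges j χ) Y`: the only vertices the modification can drop are
`Y + (0, 2)` (case `B2b`; row `≥ 4`) and `Y - (0, 2)` (case `C2b`), and the latter is not `e₀` since
then the case vertex `Y + (1, -2) = (2, 0)` would have only one admissible polygon-neighbour.
[folklore] -/
theorem isV_modify_e₀ {j : ℕ} {χ : ℕ → Site 2} {Y : Site 2} (hχ : χ ∈ lexRooted j) (hj : 3 ≤ j)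
    (hY1 : 2 ≤ Y 1) (hcorr : ∀ s t : ℤ, 1 ≤ s → -1 ≤ t → t ≤ 1 → ¬ IsV (pedges j χ) (Y + ![s, t]))
    (hsurv : ∀ p : Site 2, IsV (pedges j χ) p → (p = pt Y (0, 2) → caseOf (pedges j χ) Y ≠ JCase.B2b) →
      (p = pt Y (0, -2) → caseOf (pedges j χ) Y ≠ JCase.C2b) → IsV (modify (pedges j χ) Y) p) :
    IsV (modify (pedges j χ) Y) e₀ := by
  have hsaw := lexRooted_subset j hχ
  obtain ⟨-, hend, -, -⟩ := Zd.mem_sawFun.1 hsaw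
  obtain ⟨k0, k1, k2, k3⟩ := e₀_e₁_apply
  have he₀ : IsV (pedges j χ) e₀ :=
    exists_mem_pedges_iff.2 (by rw [← hend j le_rfl]; exact apply_mem_verts χ le_rfl)
  refine hsurv e₀ he₀ (fun heq => ?_) (fun heq hc => ?_)
  · have h := congrFun heq 1
    rw [(pt_mk_apply Y 0 2).2] at h
    omega
  · -- case `C2b` with `e₀ = Y - (0, 2)`, i.e. `Y = (1, 2)`
    have hY0 : Y 0 = 0 + 1 := by have h := congrFun heq 0; rw [(pt_mk_apply Y 0 (-2)).1] at h; omega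
    have hY1' : Y 1 = 2 := by have h := congrFun heq 1; rw [(pt_mk_apply Y 0 (-2)).2] at h; omega
    obtain ⟨hd, hr⟩ : IsV (pedges j χ) (pt Y (1, -2)) ∧
        s(pt Y (1, -2), pt Y (2, -2)) ∉ pedges j χ := by
      have hc₀ := hc; unfold caseOf at hc₀; split_ifs at hc₀; exact ⟨‹_›, ‹_›⟩
    obtain ⟨i, hi, hχi⟩ := mem_verts_iff.1 (exists_mem_pedges_iff.1 hd)
    obtain ⟨p, hp, q, hq, hpq, hap, haq, hpe, hqe⟩ := two_neighbours hsaw (by omega) hi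
    rw [hχi] at hap haq hpe hqe
    obtain ⟨d0, d1⟩ := pt_mk_apply Y 1 (-2)
    -- the only admissible polygon-neighbour of `d' = Y + (1, -2)` is `d' - e₀`
    have key : ∀ w ∈ verts j χ, (zdGraph 2).Adj (pt Y (1, -2)) w →
        s(pt Y (1, -2), w) ∈ pedges j χ → w = pt Y (1, -2) - e₀ := by
      intro w hw hadj hwe
      rcases adj_cases hadj with rfl | rfl | rfl | rfl
      · refine absurd ?_ hr
        convert hwe using 3
        obtain ⟨f0, f1⟩ := pt_mk_apply Y 2 (-2)
        exact site_eq (by rw [Pi.add_apply, k0]; omega) (by rw [Pi.add_apply, k1]; omega)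
      · rfl
      · exfalso
        refine hcorr 1 (-1) le_rfl (by norm_num) (by norm_num) (exists_mem_pedges_iff.2 ?_)
        convert hw using 1
        obtain ⟨f0, f1⟩ := vadd_apply Y 1 (-1)
        exact site_eq (by rw [f0, Pi.add_apply, k2]; omega) (by rw [f1, Pi.add_apply, k3]; omega)
      · exfalso
        obtain ⟨i', hi', hχi'⟩ := mem_verts_iff.1 hw
        have h0 := apply_one_nonneg_of_mem_lexRooted hχ hi'
        rw [hχi', Pi.sub_apply, k3] at h0
        omega
    exact hpq ((key p hp hap hpe).trans (key q hq haq hqe).symm)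

/-! ## The partner through the rotation -/

/-- **The partner's side.** Let `S` be a polygon of `ℤ²` and `Y` a site whose LEFT corridor
`{Y + (-s, t) : s ≥ 1, |t| ≤ 1}` contains no vertex of `S` and whose vertical 3-window meets `S`; let
`M = modify (rotE Y S) Y` be the modification of the rotation of `S` about `Y`, `o = outOff` of its
case, and `Ŝ = rotE Y M + (T, 0)` the rotated-back modification translated by `T`. Then `Ŝ` is a
polygon with `#S + 8` edges containing the vertical edge `{Y + (T - o, 0), Y + (T - o, 1)}`; its vertices
in the window rows have abscissa `≥ Y 0 + T - o`; every vertex of `Ŝ` is a translate of a vertex of `S`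
or lies in the box `[Y 0 + T - o, Y 0 + T] × [b 1 - 2, b 1 + 2]` for a window vertex `b` of `S`; every
vertex of `S` but at most one has its translate on `Ŝ`; and `unmodify` inverts `M`.
[cite: Hammond2015SAPJoining, §4.1 (modify σ: rotate about Y, modify, rotate back, translate by T₂)] -/
theorem sigma_side : ∀ (S : Finset (Sym2 (Site 2))) (Y : Site 2) (T : ℤ), IsPolygon (zdGraph 2) S → (∀ s t : ℤ, 1 ≤ s → -1 ≤ t → t ≤ 1 → ¬ IsV S (Y + ![-s, t])) → (IsV S (Y - e₁) ∨ IsV S Y ∨ IsV S (Y + e₁)) → IsPolygon (zdGraph 2) (trE ![T, 0] (rotE Y (modify (rotE Y S) Y))) ∧ (trE ![T, 0] (rotE Y (modify (rotE Y S) Y))).card = S.card + 8 ∧ s(pt Y (T - outOff (caseOf (rotE Y S) Y), 0), pt Y (T - outOff (caseOf (rotE Y S) Y), 1)) ∈ trE ![T, 0] (rotE Y (modify (rotE Y S) Y)) ∧ (∀ p : Site 2, IsV (trE ![T, 0] (rotE Y (modify (rotE Y S) Y))) p → -1 ≤ p 1 - Y 1 → p 1 - Y 1 ≤ 1 → Y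 0 + T - outOff (caseOf (rotE Y S) Y) ≤ p 0) ∧ (∃ b : Site 2, IsV S b ∧ b 0 = Y 0 ∧ Y 1 - 1 ≤ b 1 ∧ b 1 ≤ Y 1 + 1 ∧ ∀ p : Site 2, IsV (trE ![T, 0] (rotE Y (modify (rotE Y S) Y))) p → IsV S (p - ![T, 0]) ∨ (Y 0 + T - outOff (caseOf (rotE Y S) Y) ≤ p 0 ∧ p 0 ≤ Y 0 + T ∧ b 1 - 2 ≤ p 1 ∧ p 1 ≤ b 1 + 2)) ∧ (∃ x : Site 2, ∀ w : Site 2, IsV S w → w ≠ x → IsV (trE ![T, 0] (rotE Y (modify (rotE Y S) Y))) (w + ![T, 0])) ∧ unmodify (caseOf (rotE Y S) Y) (modify (rotE Y S) Y) Y = rotE Y S := by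
  intro S Y T hS hcorr hwin
  have hS' : IsPolygon (zdGraph 2) (rotE Y S) := isPolygon_rotE Y hS
  have hcorr' : ∀ s t : ℤ, 1 ≤ s → -1 ≤ t → t ≤ 1 → ¬ IsV (rotE Y S) (Y + ![s, t]) := by
    intro s t hs ht1 ht2 h
    rw [isV_rotE_iff, rotY_vadd] at h
    exact hcorr s (-t) hs (by omega) (by omega) h
  have hwin' : IsV (rotE Y S) (Y - e₁) ∨ IsV (rotE Y S) Y ∨ IsV (rotE Y S) (Y + e₁) := by
    obtain ⟨w1, w2, w3⟩ := rotY_window Y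
    rw [isV_rotE_iff, isV_rotE_iff, isV_rotE_iff, w1, w2, w3]
    tauto
  obtain ⟨h1, h2, h3, -, h5, ⟨a, haV, ha0, ha1, ha1', h6⟩, h7, h8⟩ :=
    modify_uniform (rotE Y S) Y hS' hcorr' hwin'
  -- vertices of the translated, rotated-back modification, in coordinates
  have hV : ∀ p : Site 2, IsV (trE ![T, 0] (rotE Y (modify (rotE Y S) Y))) p ↔
      IsV (modify (rotE Y S) Y) (rotY Y (p - ![T, 0])) := fun p => by
    rw [isV_trE_iff, isV_rotE_iff]
  have hc : ∀ p : Site 2, rotY Y (p - ![T, 0]) 0 = 2 * Y 0 - p 0 + T ∧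
      rotY Y (p - ![T, 0]) 1 = 2 * Y 1 - p 1 := fun p => by
    obtain ⟨c0, c1⟩ := rotY_coord Y (p - ![T, 0])
    obtain ⟨l0, l1⟩ := vsub_apply p T 0
    exact ⟨by omega, by omega⟩
  obtain ⟨ra0, ra1⟩ := rotY_coord Y a
  refine ⟨isPolygon_trE _ (isPolygon_rotE Y h1), ?_, ?_, ?_, ⟨rotY Y a, isV_rotE_iff.1 haV,
    by omega, by omega, by omega, fun p hp => ?_⟩, ?_, h8⟩
  · rw [card_trE_eq, card_rotE_eq, h2, card_rotE_eq]
  · rw [mk_mem_trE_iff, mk_mem_rotE_iff, Sym2.eq_swap]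
    convert h3 using 3
    · obtain ⟨c0, c1⟩ := hc (pt Y (T - outOff (caseOf (rotE Y S) Y), 1))
      obtain ⟨d0, d1⟩ := pt_mk_apply Y (T - outOff (caseOf (rotE Y S) Y)) 1
      obtain ⟨f0, f1⟩ := pt_mk_apply Y (outOff (caseOf (rotE Y S) Y)) (-1)
      exact site_eq (by omega) (by omega)
    · obtain ⟨c0, c1⟩ := hc (pt Y (T - outOff (caseOf (rotE Y S) Y), 0))
      obtain ⟨d0, d1⟩ := pt_mk_apply Y (T - outOff (caseOf (rotE Y S) Y)) 0
      obtain ⟨f0, f1⟩ := pt_mk_apply Y (outOff (caseOf (rotE Y S) Y)) 0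
      exact site_eq (by omega) (by omega)
  · intro p hp hr1 hr2
    rw [hV] at hp
    have h := h5 _ hp
    obtain ⟨c0, c1⟩ := hc p
    omega
  · rw [hV] at hp
    rcases h6 _ hp with h | ⟨b1, b2, b3, b4⟩
    · left
      rwa [isV_rotE_iff, rotY_rotY] at h
    · right
      obtain ⟨c0, c1⟩ := hc p
      omega
  · by_cases hC : caseOf (rotE Y S) Y = JCase.C2b
    · refine ⟨rotY Y (pt Y (0, -2)), fun w hw hne => ?_⟩
      rw [hV, add_sub_cancel_right]
      refine h7 (rotY Y w) (isV_rotE_iff.2 (by rwa [rotY_rotY])) (fun _ => by rw [hC]; decide)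
        fun heq => absurd ?_ hne
      rw [← heq, rotY_rotY]
    · refine ⟨rotY Y (pt Y (0, 2)), fun w hw hne => ?_⟩
      rw [hV, add_sub_cancel_right]
      refine h7 (rotY Y w) (isV_rotE_iff.2 (by rwa [rotY_rotY])) (fun heq => absurd ?_ hne)
        fun _ => hC
      rw [← heq, rotY_rotY]

end Summit.CriticalPhenomena.SAWScalingLimit.Theorems.CriticalBubbleBound.Join

end
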